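import Summits.QuantumFields.YangMills.Theorems.BalabanUVNodesN16AxialGaugeBall
import HarnessLib

/-!
# Route «BalabanUVNodes» (K3⁷ `SpineGivenEndpointR13SepCoPH`, stmt-QuantumFields-20544), DAG node N16 = NE3, in-edge N07 → N16 —
# THE COMB GAUGE CENTRED AT A SITE: ZEROTH, FIRST AND SECOND DIFFERENCES OF ITS BOND VARIABLES ON THE ℓ¹-BALL OF RADIUS TWO
# from `SmallField U α` and the covariant plaquette differences `≤ γ` (file 16 of the lineage; sequel of file 15 `…N16AxialGaugeBall` p623541)

Cell `pub-ymgap`, width seat `pub-ymgap-dag-n16-w1` (director-ym №197 ∕ HUMAN RULING D-0149), generation 7.  `--kind proof --supports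
stmt-QuantumFields-20544 --as helper` (count-neutral).  `bears_on: R4∕N16 · edge N07 → N16`.  THEOREMS ONLY (0 `def`, 0 `sorry`, standard axioms),
BY NAME over file 15 (the bond formulas `axial_centre` ∕ `axial_vec_of_{lt,not_lt}` ∕ `axial_vec_add_vec_of_*`, the loop letters
`norm_lplaq_sub_one_le`, `norm_covDiff_lplaq_{true,false}_le`), `B7Prop1Explicit` (`axial_bond_bound`, `norm_mlog_sub_le`, `expRem`) and `MatrixLog`.

CONTENT — the three numbers of [Balaban1985Variational] Thm 1 (9)_{β₀=1} for the comb gauge `V₀ = U^{v₀}`, `v₀ = U(Γ_{x₀,·})`, CENTRED AT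
THE SITE `x₀`, in terms of the gauge-invariant sup data `α` (plaquettes) and `γ` (covariant forward differences of the plaquette variables):
§0 letters — products (`‖A′B′ − AB‖ ≤ ‖A′−A‖ + ‖B′−B‖`, `‖AB − A − B + 1‖ ≤ ‖A−1‖‖B−1‖`), the logarithm (`‖mlog W − (W−1)‖ ≤ expRem 2t`,
   `expRem 4α ≤ 16α²`), and `|v|₁ ≤ 1 ⇒ v = 0 ∨ v = ±e_κ`;
§1 ★ `norm_axial_sub_one_le`: `‖V₀(y,τ) − 1‖ ≤ 2α` for `|y − x₀|₁ ≤ 2` (`axial_bond_bound`); ★★ `norm_axial_fd_le`: `‖V₀(y+e_i,τ) − V₀(y,τ)‖ ≤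
   α + γ + 2α²` for `|y − x₀|₁ ≤ 1` — FACTOR ONE in front of `α`: in the centred comb gauge a first difference is one plaquette plus at most one
   covariant plaquette difference (nine cases: centre; high∕low letter × high∕low step, above∕below∕equal in comb order, backward letter returning
   to the centre); ★★ `norm_axial_sd_le`: `‖V₀(x₀+e_i+e_l) − V₀(x₀+e_i) − V₀(x₀+e_l) + V₀(x₀)‖ ≤ γ + α²` (one covariant difference + a product of two
   plaquette deviations; six cases).  File 17 `…N16ExpGaugeOfSupData` takes logarithms (`ExpGauge11`), file 18 `…N16SlotKeyOfSupData` feeds the slot key.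

HONEST FRAMING.  Lattice kinematics ([Balaban1985Averaging] (8)–(9), pp. 24–25) + the tree's log letters, [folklore] bookkeeping BY NAME; NOTHING
of Bałaban's theorems asserted or refuted; no minimiser appears; `stub_reg910Slot` NOT closed (its (10)-type clause stays node N07's content); no
stub of K3⁷ v5 named or closed; N16 ∕ N07 NOT discharged; count-neutral; counts of record unmoved (typed 28∕28 · discharged 5∕27, A 5∕28); one
finite four-torus at fixed `ε`, Bałaban AS PRINTED — NOT ℝ⁴, NOT infinite volume, NOT OS, NOT a mass gap; the YM mass gap (Clay) is NOT proved by
any of this — R4 closes the conditional finite-𝕋⁴ rung `BalabanLadder.UV` only.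
-/

set_option autoImplicit false

open scoped BigOperators Matrix Matrix.Norms.L2Operator
open NormedSpace

namespace Summit.QuantumFields.YangMills.BalabanUVNodes.N16CombGaugeDifferences

open Literature.MathematicalPhysics.QuantumFieldTheory.Balaban1983to89
open B7Prop1Explicit B7Prop2Explicit MatrixLog
open T4AveragingDeficitWall hiding Site Plane Plaq Bond
open Summit.QuantumFields.BalabanUV.T4Continuum
open AveragingDeficitTransport (mem_U1_of_unitary norm_Ad_of_unitary)
open AveragingDeficitLatticeH2Prep (fd)
open MinimalActionHexDictionary (ExpGauge11)
open Summit.QuantumFields.YangMills.BalabanUVNodes.N16AxialGaugeBall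

noncomputable section

variable {d : ℕ} {n : Type*} [Fintype n] [DecidableEq n] [Nonempty n]

/-! ## §0 Three elementary letters (products and the logarithm) -/

omit [Nonempty n] in
/-- `‖A′B′ − AB‖ ≤ ‖A′ − A‖ + ‖B′ − B‖` when `‖B′‖, ‖A‖ ≤ 1`. [folklore] -/
theorem norm_mul_sub_mul_le_add {A A' B B' : Matrix n n ℂ} (hB' : ‖B'‖ ≤ 1) (hA : ‖A‖ ≤ 1) :
    ‖A' * B' - A * B‖ ≤ ‖A' - A‖ + ‖B' - B‖ := by
  have e1 : A' * B' - A * B = (A' - A) * B' + A * (B' - B) := by noncomm_ring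
  rw [e1]
  calc _ ≤ ‖(A' - A) * B'‖ + ‖A * (B' - B)‖ := norm_add_le _ _
    _ ≤ ‖A' - A‖ * ‖B'‖ + ‖A‖ * ‖B' - B‖ := add_le_add (norm_mul_le _ _) (norm_mul_le _ _)
    _ ≤ ‖A' - A‖ * 1 + 1 * ‖B' - B‖ := by gcongr
    _ = ‖A' - A‖ + ‖B' - B‖ := by ring

omit [Nonempty n] in
/-- `‖AB − A − B + 1‖ ≤ ‖A − 1‖·‖B − 1‖` (`AB − A − B + 1 = (A−1)(B−1)`). [folklore] -/
theorem norm_mul_sub_sub_add_one_le (A B : Matrix n n ℂ) : ‖A * B - A - B + 1‖ ≤ ‖A - 1‖ * ‖B - 1‖ := by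
  have e1 : A * B - A - B + 1 = (A - 1) * (B - 1) := by noncomm_ring
  rw [e1]; exact norm_mul_le _ _

omit [Nonempty n] in
/-- The logarithm letter: for `‖W − 1‖ ≤ t ≤ 1∕2`, `‖mlog W − (W − 1)‖ ≤ expRem (2t)` and `‖mlog W‖ ≤ t + expRem (2t)`
(`B7Prop1Explicit.norm_mlog_sub_le`, [Balaban1985Averaging] (26)–(27)). [folklore] -/
theorem norm_mlog_letters {W : Matrix n n ℂ} {t : ℝ} (hW : ‖W - 1‖ ≤ t) (ht : t ≤ 1 / 2) :
    ‖mlog W - (W - 1)‖ ≤ expRem (2 * t) ∧ ‖mlog W‖ ≤ t + expRem (2 * t) := by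
  have h1 : ‖mlog W - (W - 1)‖ ≤ expRem (2 * t) :=
    (norm_mlog_sub_le (hW.trans ht)).trans (expRem_mono (by positivity) (by linarith))
  refine ⟨h1, ?_⟩
  calc ‖mlog W‖ = ‖(W - 1) + (mlog W - (W - 1))‖ := by rw [add_sub_cancel]
    _ ≤ ‖W - 1‖ + ‖mlog W - (W - 1)‖ := norm_add_le _ _
    _ ≤ t + expRem (2 * t) := add_le_add hW h1

omit [Fintype n] [DecidableEq n] [Nonempty n] in
/-- `expRem (4α) ≤ 16α²` for `0 ≤ α ≤ 1∕4`. [folklore] -/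
theorem expRem_four_mul_le {α : ℝ} (h0 : 0 ≤ α) (h1 : α ≤ 1 / 4) : expRem (4 * α) ≤ 16 * α ^ 2 := by
  have := expRem_le_sq (t := 4 * α) (by positivity) (by linarith)
  nlinarith [this]

omit [Fintype n] [DecidableEq n] [Nonempty n] in
/-- A lattice vector of `ℓ¹`-length `≤ 1` is `0` or a single letter `±e_κ`. [folklore] -/
theorem eq_zero_or_eq_vec_of_l1_le_one (v : Site d) (h : l1 v ≤ 1) : v = 0 ∨ ∃ l : Letter d, v = l.vec := by
  by_cases hv : v = 0
  · exact Or.inl hv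
  · right
    obtain ⟨κ, hκ⟩ : ∃ κ, v κ ≠ 0 := by
      by_contra hcon
      exact hv (funext fun κ => not_not.mp (not_exists.mp hcon κ))
    -- the other coordinates vanish and `|v κ| = 1`
    have hsum : (v κ).natAbs + ∑ μ ∈ Finset.univ.erase κ, (v μ).natAbs = l1 v :=
      Finset.add_sum_erase Finset.univ (fun μ => (v μ).natAbs) (Finset.mem_univ κ)
    have hκ1 : 1 ≤ (v κ).natAbs := Int.natAbs_pos.mpr hκ
    have hrest : ∑ μ ∈ Finset.univ.erase κ, (v μ).natAbs = 0 := by omega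
    have hκ1' : (v κ).natAbs = 1 := by omega
    have hother : ∀ μ, μ ≠ κ → v μ = 0 := by
      intro μ hμ
      have := Finset.sum_eq_zero_iff.mp hrest μ (Finset.mem_erase.mpr ⟨hμ, Finset.mem_univ μ⟩)
      exact Int.natAbs_eq_zero.mp this
    rcases Int.natAbs_eq_iff.mp hκ1' with h1 | h1
    · refine ⟨(κ, true), funext fun μ => ?_⟩
      by_cases hμ : μ = κ
      · subst hμ; simp [h1, e_apply]
      · simp [hother μ hμ, e_apply, hμ]
    · refine ⟨(κ, false), funext fun μ => ?_⟩
      by_cases hμ : μ = κ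
      · subst hμ; simp [h1, e_apply]
      · simp [hother μ hμ, e_apply, hμ]

/-! ## §1 The comb gauge centred at `x₀`: its bond variables on the ball, their first differences within distance one,
and their second differences at the centre -/

/-- **ZEROTH ORDER**: within `ℓ¹`-distance `2` of the centre every bond variable of the comb gauge is within `2α` of `1`
(`B7Prop1Explicit.axial_bond_bound`, [Balaban1985Averaging] p. 25 l. 3). [cite: Balaban1985Averaging, p.25] -/
theorem norm_axial_sub_one_le {U : Site d → Fin d → (Matrix n n ℂ)ˣ} (hU : IsUnitaryCfg U) {α : ℝ} (hα : 0 ≤ α)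
    (hS : SmallField U α) (x₀ y : Site d) (τ : Fin d) (hy : l1 (y - x₀) ≤ 2) :
    ‖((gaugeAct (axialFn U x₀) U y τ : (Matrix n n ℂ)ˣ) : Matrix n n ℂ) - 1‖ ≤ 2 * α := by
  have h := axial_bond_bound U (u1_of_isUnitaryCfg hU) x₀ hS hα y τ
  have h2 : (l1 (y - x₀) : ℝ) ≤ 2 := by exact_mod_cast hy
  exact h.trans (by nlinarith)

/-- **FIRST DIFFERENCES WITHIN DISTANCE ONE** — the heart of the kinematic half: in the comb gauge centred at `x₀`, for
`|y − x₀|₁ ≤ 1` and every direction `i`, `‖V₀(y + e_i, τ) − V₀(y, τ)‖ ≤ α + γ + 2α²` — ONE plaquette (`α`) plus at most ONE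
covariant plaquette difference (`γ`, or `γ + 2α²` for a backward letter), by the bond formulas of file 15 (cases: centre; one
high ∕ low letter; the added step high ∕ low, above ∕ below the letter in comb order, equal to it). [folklore] -/
theorem norm_axial_fd_le {U : Site d → Fin d → (Matrix n n ℂ)ˣ} (hU : IsUnitaryCfg U) {α γ : ℝ} (hα : 0 ≤ α)
    (hγ0 : 0 ≤ γ) (hS : SmallField U α)
    (hγ : ∀ (x : Site d) (κ : Fin d) (π : T4AveragingDeficitWall.Plane d),
      ‖covGrad U (fun q => ((fhol U q : (Matrix n n ℂ)ˣ) : Matrix n n ℂ)) x κ π‖ ≤ γ)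
    (x₀ y : Site d) (hy : l1 (y - x₀) ≤ 1) (τ i : Fin d) :
    ‖((gaugeAct (axialFn U x₀) U (y + e i) τ : (Matrix n n ℂ)ˣ) : Matrix n n ℂ)
        - ((gaugeAct (axialFn U x₀) U y τ : (Matrix n n ℂ)ˣ) : Matrix n n ℂ)‖ ≤ α + γ + 2 * α ^ 2 := by
  have hV1 := u1_of_isUnitaryCfg hU
  have hαγ : (0 : ℝ) ≤ γ + 2 * α ^ 2 := by positivity
  -- norms of loops and of `U1` elements
  have hloop : ∀ (p : Site d) (l : Letter d) (μ : Fin d), l.1 ≠ μ →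
      ‖((hol U p (lplaqWord l μ) : (Matrix n n ℂ)ˣ) : Matrix n n ℂ) - 1‖ ≤ α :=
    fun p l μ h => norm_lplaq_sub_one_le hU hS p l μ h
  have hn1 : ∀ W : (Matrix n n ℂ)ˣ, W ∈ U1 (Matrix n n ℂ) → ‖(W : Matrix n n ℂ)‖ ≤ 1 := fun W h => h.1
  have hei : e i = Letter.vec ((i, true) : Letter d) := rfl
  rcases eq_zero_or_eq_vec_of_l1_le_one (y - x₀) hy with h0 | ⟨l, hl⟩
  · -- the centre
    have hy0 : y = x₀ := by rwa [sub_eq_zero] at h0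
    subst hy0
    rw [axial_centre, hei]
    by_cases hiτ : i < τ
    · rw [axial_vec_of_lt U y (l := (i, true)) hiτ, Units.val_one]
      exact (hloop y (i, true) τ (ne_of_lt hiτ)).trans (by nlinarith)
    · rw [axial_vec_of_not_lt U y (l := (i, true)) hiτ, Units.val_one, sub_self, norm_zero]; positivity
  · -- one letter `l` from the centre
    have hy1 : y = x₀ + l.vec := by rw [← hl]; abel
    subst hy1
    by_cases hlτ : l.1 < τ
    · by_cases hiτ : i < τ
      · -- both low
        rcases lt_trichotomy l.1 i with hli | hli | hli
        · -- `l.1 < i`: comb order `(i,+)` then `l`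
          have hz : x₀ + l.vec + e i = x₀ + Letter.vec ((i, true) : Letter d) + l.vec := by rw [hei]; abel
          rw [hz, axial_vec_add_vec_of_lt_of_lt U x₀ (l₁ := (i, true)) (l₂ := l) hiτ hlτ (Or.inl hli),
            axial_vec_of_lt U x₀ hlτ]
          simp only [Units.val_mul, stepHol_true, Letter.vec_true]
          have hA : ‖((hol U x₀ (lplaqWord l τ) : (Matrix n n ℂ)ˣ) : Matrix n n ℂ)‖ ≤ 1 := hn1 _ (hol_mem hV1 _ _)
          have hB : ‖((hol U x₀ (lplaqWord (i, true) τ) : (Matrix n n ℂ)ˣ) : Matrix n n ℂ)‖ ≤ 1 :=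
            hn1 _ (hol_mem hV1 _ _)
          have key := norm_mul_sub_mul_le_add (A := ((hol U x₀ (lplaqWord l τ) : (Matrix n n ℂ)ˣ) : Matrix n n ℂ))
            (A' := ((U x₀ i : (Matrix n n ℂ)ˣ) : Matrix n n ℂ) * ((hol U (x₀ + e i) (lplaqWord l τ) : (Matrix n n ℂ)ˣ) :
              Matrix n n ℂ) * (((U x₀ i)⁻¹ : (Matrix n n ℂ)ˣ) : Matrix n n ℂ))
            (B := (1 : Matrix n n ℂ)) hB hA
          rw [mul_one] at key
          refine key.trans ?_
          -- the covariant difference (forward or backward letter) + one plaquette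
          have h1 : ‖((U x₀ i : (Matrix n n ℂ)ˣ) : Matrix n n ℂ) * ((hol U (x₀ + e i) (lplaqWord l τ) : (Matrix n n ℂ)ˣ) :
                Matrix n n ℂ) * (((U x₀ i)⁻¹ : (Matrix n n ℂ)ˣ) : Matrix n n ℂ)
              - ((hol U x₀ (lplaqWord l τ) : (Matrix n n ℂ)ˣ) : Matrix n n ℂ)‖ ≤ γ + 2 * α ^ 2 := by
            obtain ⟨j, b⟩ := l
            cases b
            · exact norm_covDiff_lplaq_false_le hU hα hS hγ x₀ hlτ (ne_of_gt hli)
            · exact (norm_covDiff_lplaq_true_le hγ x₀ i hlτ).trans (by nlinarith)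
          have h2 := hloop x₀ (i, true) τ (ne_of_lt hiτ)
          linarith
        · -- `l.1 = i`
          obtain ⟨j, b⟩ := l
          simp only at hli
          subst hli
          cases b
          · -- backward letter then forward step: back at the centre
            have hz : x₀ + Letter.vec ((j, false) : Letter d) + e j = x₀ := by simp
            rw [hz, axial_centre, axial_vec_of_lt U x₀ hlτ, Units.val_one, norm_sub_rev]
            exact (hloop x₀ (j, false) τ (ne_of_lt hlτ)).trans (by nlinarith)
          · -- repeated forward letter: the two-rung ladder in one direction
            rw [hei, axial_vec_add_vec_of_lt_of_lt U x₀ (l₁ := (j, true)) (l₂ := (j, true)) hlτ hlτ (Or.inr rfl),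
              axial_vec_of_lt U x₀ hlτ]
            simp only [Units.val_mul, stepHol_true, Letter.vec_true]
            have hA : ‖((hol U x₀ (lplaqWord (j, true) τ) : (Matrix n n ℂ)ˣ) : Matrix n n ℂ)‖ ≤ 1 :=
              hn1 _ (hol_mem hV1 _ _)
            have key := norm_mul_sub_mul_le_add (A := (1 : Matrix n n ℂ))
              (A' := ((U x₀ j : (Matrix n n ℂ)ˣ) : Matrix n n ℂ) * ((hol U (x₀ + e j) (lplaqWord (j, true) τ) :
                (Matrix n n ℂ)ˣ) : Matrix n n ℂ) * (((U x₀ j)⁻¹ : (Matrix n n ℂ)ˣ) : Matrix n n ℂ))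
              (B := ((hol U x₀ (lplaqWord (j, true) τ) : (Matrix n n ℂ)ˣ) : Matrix n n ℂ)) hA (by simp)
            rw [one_mul, sub_self, norm_zero, add_zero] at key
            refine key.trans ?_
            have := norm_units_conj_sub_one_le (hV1 x₀ j)
              ((hol U (x₀ + e j) (lplaqWord (j, true) τ) : (Matrix n n ℂ)ˣ) : Matrix n n ℂ)
            exact (this.trans (hloop _ (j, true) τ (ne_of_lt hlτ))).trans (by nlinarith)
        · -- `i < l.1`: comb order `l` then `(i,+)`
          rw [hei, axial_vec_add_vec_of_lt_of_lt U x₀ (l₁ := l) (l₂ := (i, true)) hlτ hiτ (Or.inl hli),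
            axial_vec_of_lt U x₀ hlτ]
          simp only [Units.val_mul]
          have hA : ‖((hol U x₀ (lplaqWord l τ) : (Matrix n n ℂ)ˣ) : Matrix n n ℂ)‖ ≤ 1 := hn1 _ (hol_mem hV1 _ _)
          have key := norm_mul_sub_mul_le_add (A := (1 : Matrix n n ℂ))
            (A' := ((stepHol U x₀ l : (Matrix n n ℂ)ˣ) : Matrix n n ℂ) *
              ((hol U (x₀ + l.vec) (lplaqWord (i, true) τ) : (Matrix n n ℂ)ˣ) : Matrix n n ℂ) *
              (((stepHol U x₀ l)⁻¹ : (Matrix n n ℂ)ˣ) : Matrix n n ℂ))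
            (B := ((hol U x₀ (lplaqWord l τ) : (Matrix n n ℂ)ˣ) : Matrix n n ℂ)) hA (by simp)
          rw [one_mul, sub_self, norm_zero, add_zero] at key
          refine key.trans ?_
          have := norm_units_conj_sub_one_le (stepHol_mem hV1 x₀ l)
            ((hol U (x₀ + l.vec) (lplaqWord (i, true) τ) : (Matrix n n ℂ)ˣ) : Matrix n n ℂ)
          exact (this.trans (hloop _ (i, true) τ (ne_of_lt hiτ))).trans (by nlinarith)
      · -- low letter, high step: a covariant difference
        have hil : i ≠ l.1 := fun h => hiτ (h ▸ hlτ)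
        have hz : x₀ + l.vec + e i = x₀ + Letter.vec ((i, true) : Letter d) + l.vec := by rw [hei]; abel
        rw [hz, axial_vec_add_vec_of_not_lt_of_lt U x₀ (l₁ := (i, true)) (l₂ := l) hiτ hlτ, axial_vec_of_lt U x₀ hlτ]
        simp only [Units.val_mul, stepHol_true, Letter.vec_true]
        obtain ⟨j, b⟩ := l
        cases b
        · exact (norm_covDiff_lplaq_false_le hU hα hS hγ x₀ hlτ hil).trans (by nlinarith)
        · exact (norm_covDiff_lplaq_true_le hγ x₀ i hlτ).trans (by nlinarith)
    · by_cases hiτ : i < τ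
      · -- high letter, low step: a transported plaquette
        rw [hei, axial_vec_add_vec_of_not_lt_of_lt U x₀ (l₁ := l) (l₂ := (i, true)) hlτ hiτ,
          axial_vec_of_not_lt U x₀ hlτ]
        simp only [Units.val_mul, Units.val_one]
        have := norm_units_conj_sub_one_le (stepHol_mem hV1 x₀ l)
          ((hol U (x₀ + l.vec) (lplaqWord (i, true) τ) : (Matrix n n ℂ)ˣ) : Matrix n n ℂ)
        exact (this.trans (hloop _ (i, true) τ (ne_of_lt hiτ))).trans (by nlinarith)
      · -- both high: tree bonds
        rw [hei, axial_vec_add_vec_of_not_lt_of_not_lt U x₀ (l₁ := l) (l₂ := (i, true)) hlτ hiτ,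
          axial_vec_of_not_lt U x₀ hlτ, sub_self, norm_zero]
        positivity

/-- **SECOND DIFFERENCES AT THE CENTRE**: for all directions `i, l`,
`‖V₀(x₀+e_i+e_l, τ) − V₀(x₀+e_i, τ) − V₀(x₀+e_l, τ) + V₀(x₀, τ)‖ ≤ γ + α²` — one covariant plaquette difference plus the
product of two plaquette deviations (only forward letters occur). [folklore] -/
theorem norm_axial_sd_le {U : Site d → Fin d → (Matrix n n ℂ)ˣ} (hU : IsUnitaryCfg U) {α γ : ℝ} (hα : 0 ≤ α)
    (hγ0 : 0 ≤ γ) (hS : SmallField U α)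
    (hγ : ∀ (x : Site d) (κ : Fin d) (π : T4AveragingDeficitWall.Plane d),
      ‖covGrad U (fun q => ((fhol U q : (Matrix n n ℂ)ˣ) : Matrix n n ℂ)) x κ π‖ ≤ γ)
    (x₀ : Site d) (τ i l : Fin d) :
    ‖((gaugeAct (axialFn U x₀) U (x₀ + e i + e l) τ : (Matrix n n ℂ)ˣ) : Matrix n n ℂ)
        - ((gaugeAct (axialFn U x₀) U (x₀ + e i) τ : (Matrix n n ℂ)ˣ) : Matrix n n ℂ)
        - ((gaugeAct (axialFn U x₀) U (x₀ + e l) τ : (Matrix n n ℂ)ˣ) : Matrix n n ℂ)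
        + ((gaugeAct (axialFn U x₀) U x₀ τ : (Matrix n n ℂ)ˣ) : Matrix n n ℂ)‖ ≤ γ + α ^ 2 := by
  have hV1 := u1_of_isUnitaryCfg hU
  have hαγ : (0 : ℝ) ≤ γ + α ^ 2 := by positivity
  have hloop : ∀ (p : Site d) (l : Letter d) (μ : Fin d), l.1 ≠ μ →
      ‖((hol U p (lplaqWord l μ) : (Matrix n n ℂ)ˣ) : Matrix n n ℂ) - 1‖ ≤ α :=
    fun p l μ h => norm_lplaq_sub_one_le hU hS p l μ h
  have hei : e i = Letter.vec ((i, true) : Letter d) := rfl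
  have hel : e l = Letter.vec ((l, true) : Letter d) := rfl
  rw [axial_centre, Units.val_one]
  by_cases hiτ : i < τ
  · by_cases hlτ : l < τ
    · rcases lt_trichotomy l i with hli | hli | hli
      · -- `l < i < τ`: comb order `(i,+)` then `(l,+)`
        rw [hei, hel, axial_vec_add_vec_of_lt_of_lt U x₀ (l₁ := (i, true)) (l₂ := (l, true)) hiτ hlτ (Or.inl hli),
          axial_vec_of_lt U x₀ hiτ, axial_vec_of_lt U x₀ hlτ]
        simp only [Units.val_mul, stepHol_true, Letter.vec_true]
        set X := ((U x₀ i : (Matrix n n ℂ)ˣ) : Matrix n n ℂ) * ((hol U (x₀ + e i) (lplaqWord (l, true) τ) :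
          (Matrix n n ℂ)ˣ) : Matrix n n ℂ) * (((U x₀ i)⁻¹ : (Matrix n n ℂ)ˣ) : Matrix n n ℂ) with hX
        set Pi := ((hol U x₀ (lplaqWord (i, true) τ) : (Matrix n n ℂ)ˣ) : Matrix n n ℂ)
        set Pl := ((hol U x₀ (lplaqWord (l, true) τ) : (Matrix n n ℂ)ˣ) : Matrix n n ℂ)
        have e1 : X * Pi - Pi - Pl + 1 = (X * Pi - X - Pi + 1) + (X - Pl) := by abel
        rw [e1]
        have hX1 : ‖X - 1‖ ≤ α :=
          (norm_units_conj_sub_one_le (hV1 x₀ i) _).trans (hloop _ (l, true) τ (ne_of_lt hlτ))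
        calc _ ≤ ‖X * Pi - X - Pi + 1‖ + ‖X - Pl‖ := norm_add_le _ _
          _ ≤ ‖X - 1‖ * ‖Pi - 1‖ + γ :=
              add_le_add (norm_mul_sub_sub_add_one_le X Pi) (norm_covDiff_lplaq_true_le hγ x₀ i hlτ)
          _ ≤ α * α + γ := by gcongr; exact hloop _ (i, true) τ (ne_of_lt hiτ)
          _ = γ + α ^ 2 := by ring
      · -- `l = i < τ`: the two-rung ladder in one direction
        subst hli
        rw [hei, axial_vec_add_vec_of_lt_of_lt U x₀ (l₁ := (l, true)) (l₂ := (l, true)) hiτ hiτ (Or.inr rfl),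
          axial_vec_of_lt U x₀ hiτ]
        simp only [Units.val_mul, stepHol_true, Letter.vec_true]
        set X := ((U x₀ l : (Matrix n n ℂ)ˣ) : Matrix n n ℂ) * ((hol U (x₀ + e l) (lplaqWord (l, true) τ) :
          (Matrix n n ℂ)ˣ) : Matrix n n ℂ) * (((U x₀ l)⁻¹ : (Matrix n n ℂ)ˣ) : Matrix n n ℂ) with hX
        set Pl := ((hol U x₀ (lplaqWord (l, true) τ) : (Matrix n n ℂ)ˣ) : Matrix n n ℂ)
        have e1 : X * Pl - Pl - Pl + 1 = (X * Pl - X - Pl + 1) + (X - Pl) := by abel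
        rw [e1]
        have hX1 : ‖X - 1‖ ≤ α :=
          (norm_units_conj_sub_one_le (hV1 x₀ l) _).trans (hloop _ (l, true) τ (ne_of_lt hiτ))
        calc _ ≤ ‖X * Pl - X - Pl + 1‖ + ‖X - Pl‖ := norm_add_le _ _
          _ ≤ ‖X - 1‖ * ‖Pl - 1‖ + γ :=
              add_le_add (norm_mul_sub_sub_add_one_le X Pl) (norm_covDiff_lplaq_true_le hγ x₀ l hiτ)
          _ ≤ α * α + γ := by gcongr; exact hloop _ (l, true) τ (ne_of_lt hiτ)
          _ = γ + α ^ 2 := by ring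
      · -- `i < l < τ`: comb order `(l,+)` then `(i,+)`
        have hz : x₀ + e i + e l = x₀ + Letter.vec ((l, true) : Letter d) + Letter.vec ((i, true) : Letter d) := by
          rw [hei, hel]; abel
        rw [hz, axial_vec_add_vec_of_lt_of_lt U x₀ (l₁ := (l, true)) (l₂ := (i, true)) hlτ hiτ (Or.inl hli), hei, hel,
          axial_vec_of_lt U x₀ hiτ, axial_vec_of_lt U x₀ hlτ]
        simp only [Units.val_mul, stepHol_true, Letter.vec_true]
        set X := ((U x₀ l : (Matrix n n ℂ)ˣ) : Matrix n n ℂ) * ((hol U (x₀ + e l) (lplaqWord (i, true) τ) :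
          (Matrix n n ℂ)ˣ) : Matrix n n ℂ) * (((U x₀ l)⁻¹ : (Matrix n n ℂ)ˣ) : Matrix n n ℂ) with hX
        set Pi := ((hol U x₀ (lplaqWord (i, true) τ) : (Matrix n n ℂ)ˣ) : Matrix n n ℂ)
        set Pl := ((hol U x₀ (lplaqWord (l, true) τ) : (Matrix n n ℂ)ˣ) : Matrix n n ℂ)
        have e1 : X * Pl - Pi - Pl + 1 = (X * Pl - X - Pl + 1) + (X - Pi) := by abel
        rw [e1]
        have hX1 : ‖X - 1‖ ≤ α :=
          (norm_units_conj_sub_one_le (hV1 x₀ l) _).trans (hloop _ (i, true) τ (ne_of_lt hiτ))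
        calc _ ≤ ‖X * Pl - X - Pl + 1‖ + ‖X - Pi‖ := norm_add_le _ _
          _ ≤ ‖X - 1‖ * ‖Pl - 1‖ + γ :=
              add_le_add (norm_mul_sub_sub_add_one_le X Pl) (norm_covDiff_lplaq_true_le hγ x₀ l hiτ)
          _ ≤ α * α + γ := by gcongr; exact hloop _ (l, true) τ (ne_of_lt hlτ)
          _ = γ + α ^ 2 := by ring
    · -- `i < τ ≤ l`: the step `l` transports the plaquette `(i, τ)`
      have hz : x₀ + e i + e l = x₀ + Letter.vec ((l, true) : Letter d) + Letter.vec ((i, true) : Letter d) := by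
        rw [hei, hel]; abel
      rw [hz, axial_vec_add_vec_of_not_lt_of_lt U x₀ (l₁ := (l, true)) (l₂ := (i, true)) hlτ hiτ, hei, hel,
        axial_vec_of_lt U x₀ hiτ, axial_vec_of_not_lt U x₀ hlτ]
      simp only [Units.val_mul, Units.val_one, stepHol_true, Letter.vec_true]
      rw [show ∀ X P : Matrix n n ℂ, X - P - 1 + 1 = X - P from fun X P => by abel]
      exact (norm_covDiff_lplaq_true_le hγ x₀ l hiτ).trans (by nlinarith)
  · by_cases hlτ : l < τ
    · -- `l < τ ≤ i`
      rw [hei, hel, axial_vec_add_vec_of_not_lt_of_lt U x₀ (l₁ := (i, true)) (l₂ := (l, true)) hiτ hlτ,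
        axial_vec_of_not_lt U x₀ hiτ, axial_vec_of_lt U x₀ hlτ]
      simp only [Units.val_mul, Units.val_one, stepHol_true, Letter.vec_true]
      rw [show ∀ X P : Matrix n n ℂ, X - 1 - P + 1 = X - P from fun X P => by abel]
      exact (norm_covDiff_lplaq_true_le hγ x₀ i hlτ).trans (by nlinarith)
    · -- both high
      rw [hei, hel, axial_vec_add_vec_of_not_lt_of_not_lt U x₀ (l₁ := (i, true)) (l₂ := (l, true)) hiτ hlτ,
        axial_vec_of_not_lt U x₀ hiτ, axial_vec_of_not_lt U x₀ hlτ]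
      simp only [Units.val_one, sub_self, zero_sub, neg_add_cancel, norm_zero]
      exact hαγ

end

end Summit.QuantumFields.YangMills.BalabanUVNodes.N16CombGaugeDifferences
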